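import Summits.BirchSwinnertonDyer.BirchSwinnertonDyer.Theorems.QuadraticBranchSignedControlPlusEtaNonsurjGoodFrobenius
import Literature.NumberTheory.EllipticCurves.QuadraticTwistLFunctionProofs
import Literature.NumberTheory.EllipticCurves.LFunctionSmulProofs
import Literature.NumberTheory.EllipticCurves.LFunctionPrimeCoeff
import HarnessLib

/-!
# Route `QuadraticBranchSignedControl` (rung K8, cell `bsd-potss`): crux stmt-BirchSwinnertonDyer-19606
# `PlusEtaMainConjectureNonsurj` — THE ADDITIVE PARTNER AT THE GOOD PRIMES: `a_ℓ(W) = (ℓ/p)·a_ℓ(V)`, the same discriminant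
# `a_ℓ(W)² − 4ℓ = a_ℓ(V)² − 4ℓ`, hence the discriminant law and «anomalous ⟹ ℓ ≡ ±1 (mod p)» for `W`

WHAT. Companion of `…PlusEtaNonsurjGoodFrobenius` (k8eta-c2 g13) and the partner twin of k8eta-c2 g12's
`…PartnerFrobeniusTrace` (there: the MULTIPLICATIVE primes). For the additive partner `W` of a row `V` (`C • W^{(p*)} = V`,
`p* = (−1)^{(p−1)/2} p`, both globally minimal) and a prime `ℓ ≠ p` of good reduction for both:
* §1 `frobeniusTrace_partner_eq_legendreSym_mul` — `a_ℓ(W) = (ℓ/p)·a_ℓ(V)` (ANY such pair, `p` odd: Mathlib's `L`-function is a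
  model invariant, `LFunction_smul`; its coefficients twist by `(·/p)` away from `p`, `LFunction_quadraticTwist_pStar_apply`; at a good
  prime the coefficient is the trace of Frobenius, `LFunction_apply_prime_eq_frobeniusTrace`; `(ℓ/p)² = 1`);
  `frobeniusTrace_partner_sq_eq` — `a_ℓ(W)² = a_ℓ(V)²`; `dvd_frobeniusTrace_partner_iff` — `p ∣ a_ℓ(W) ⟺ p ∣ a_ℓ(V)`.
* §2 on a ROW: **`dvd_frobeniusTrace_or_discr_partner_of_row`** — the discriminant law for `W` at every good `ℓ ≠ p`
  (`p ∣ a_ℓ(W)` ∨ `a_ℓ(W)² − 4ℓ ≡ 0` ∨ non-residue); **`natCast_eq_one_or_eq_neg_one_of_anomalous_partner_of_row`** — an anomalous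
  good prime of the PARTNER (`p ∣ ℓ + 1 − a_ℓ(W) = #W̃(𝔽_ℓ)`) is `≡ ±1 (mod p)` (the `c = (ℓ/p)` case of
  `natCast_eq_one_or_eq_neg_one_of_dvd_eulerFactor_of_row`). READING: the `η`-branch of `V` is the trivial branch of `W`; the local
  terms of the `λ`-transfer on the `η`-branch at good primes are those of `W`, and they too live only at `ℓ ≡ ±1 (mod p)`.

HONEST FRAMING (cell `bsd-potss`, run/shared/lean/pub/bsd-potss/; FULL-BSD rank ≤ 1 programme): TOOL THEOREMS ONLY (no definition,
no named fact, no `sorry`, axioms standard); the good reduction of `W` at `ℓ` is DISPLAYED as a hypothesis next to that of `V` (equivalent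
for `ℓ ∤ 2p`; not re-derived here). Nothing is booked; crux 19606 stays OPEN; `BSD(W, p)` is claimed for no pair. Seat
`bsd-potss-k8eta-c2` g13 (prover), `--supports stmt-BirchSwinnertonDyer-19606`.

References: [SilvermanAEC2009] X.2, Exercise 10.16 and Exercise 8.19 (a); [Knapp1993] Prop. 12.10; [IrelandRosen1990] Ch. 5 §2
Thm. 1 (reciprocity, `(p*/ℓ) = (ℓ/p)`); [Serre1972] §2.2.
-/

set_option autoImplicit false
set_option linter.dupNamespace false

noncomputable section

open scoped Classical NumberField

open Matrix Field IsDedekindDomain NumberField WeierstrassCurve Literature.NumberTheory.EllipticCurves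
  Literature.NumberTheory.GaloisRepresentations Literature.NumberTheory.SerreUniformity
  Literature.NumberTheory.EllipticCurves.Rank1Residual Rat.HeightOneSpectrum

namespace Summit.BirchSwinnertonDyer.BirchSwinnertonDyer.Theorems.EtaCartanField

/-! ## §1 `a_ℓ(W) = (ℓ/p)·a_ℓ(V)` at a good prime `ℓ ≠ p` -/

section Partner

variable (V W : WeierstrassCurve ℚ) [V.IsElliptic] [V.IsGloballyMinimal] [W.IsElliptic] [W.IsGloballyMinimal]
  (C : VariableChange ℚ) (p : ℕ) [hp : Fact p.Prime]

/-- **`a_ℓ(W) = (ℓ/p)·a_ℓ(V)`** for globally minimal `V, W` with `C • W^{(p*)} = V`, `p` odd, at a prime `ℓ ≠ p` of good reduction for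
both: `V.LFunction = W^{(p*)}.LFunction` (`LFunction_smul`) has `ℓ`-th coefficient `(ℓ/p)·a_ℓ(W)` (`LFunction_quadraticTwist_pStar_apply`),
and the `ℓ`-th coefficient at a good prime of a globally minimal curve is `a_ℓ` (`LFunction_apply_prime_eq_frobeniusTrace`); `(ℓ/p)² = 1`.
[cite: SilvermanAEC2009, X.2 with Exercise 10.16 and Exercise 8.19(a)] [cite: Knapp1993, Prop. 12.10] -/
theorem frobeniusTrace_partner_eq_legendreSym_mul (hp2 : p ≠ 2) (hVW : C • W.quadraticTwist ((-1) ^ (p / 2) * p) = V)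
    (ℓ : ℕ) [hℓ : Fact ℓ.Prime] (hℓp : ℓ ≠ p) (hgoodV : V.HasGoodReductionAtPrime ℓ) (hgoodW : W.HasGoodReductionAtPrime ℓ) :
    W.frobeniusTrace ℓ = legendreSym p ℓ * V.frobeniusTrace ℓ := by
  have hpℓ : ¬ p ∣ ℓ := fun h => hℓp ((Nat.prime_dvd_prime_iff_eq hp.out hℓ.out).mp h).symm
  have hcast : (((-1 : ℤ) ^ (p / 2) * p : ℤ) : ℚ) = (-1) ^ (p / 2) * p := by push_cast; ring
  have hd0 : ((-1 : ℚ) ^ (p / 2) * p) ≠ 0 :=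
    mul_ne_zero (pow_ne_zero _ (by norm_num)) (by exact_mod_cast hp.out.ne_zero)
  haveI : (W.quadraticTwist ((-1) ^ (p / 2) * p)).IsElliptic := W.isElliptic_quadraticTwist hd0
  have hLV : V.LFunction ℓ = legendreSym p ℓ * W.LFunction ℓ := by
    rw [← hVW, LFunction_smul, ← hcast, W.LFunction_quadraticTwist_pStar_apply hp2 hpℓ]
  rw [V.LFunction_apply_prime_eq_frobeniusTrace ℓ hgoodV, W.LFunction_apply_prime_eq_frobeniusTrace ℓ hgoodW] at hLV
  have hsq : legendreSym p ℓ * legendreSym p ℓ = 1 := by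
    have hℓ0 : ((ℓ : ℤ) : ZMod p) ≠ 0 := by
      rw [Int.cast_natCast, Ne, ZMod.natCast_eq_zero_iff]
      exact hpℓ
    rw [← sq]
    exact legendreSym.sq_one p hℓ0
  rw [hLV, ← mul_assoc, hsq, one_mul]

/-- **`a_ℓ(W)² = a_ℓ(V)²`** at a good prime `ℓ ≠ p` of a partner pair (so the discriminants `a_ℓ² − 4ℓ` coincide).
[cite: SilvermanAEC2009, X.2 with Exercise 10.16] -/
theorem frobeniusTrace_partner_sq_eq (hp2 : p ≠ 2) (hVW : C • W.quadraticTwist ((-1) ^ (p / 2) * p) = V)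
    (ℓ : ℕ) [hℓ : Fact ℓ.Prime] (hℓp : ℓ ≠ p) (hgoodV : V.HasGoodReductionAtPrime ℓ) (hgoodW : W.HasGoodReductionAtPrime ℓ) :
    W.frobeniusTrace ℓ ^ 2 = V.frobeniusTrace ℓ ^ 2 := by
  have hpℓ : ¬ p ∣ ℓ := fun h => hℓp ((Nat.prime_dvd_prime_iff_eq hp.out hℓ.out).mp h).symm
  have hℓ0 : ((ℓ : ℤ) : ZMod p) ≠ 0 := by
    rw [Int.cast_natCast, Ne, ZMod.natCast_eq_zero_iff]
    exact hpℓ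
  rw [frobeniusTrace_partner_eq_legendreSym_mul V W C p hp2 hVW ℓ hℓp hgoodV hgoodW, mul_pow, legendreSym.sq_one p hℓ0, one_mul]

/-- **`p ∣ a_ℓ(W) ⟺ p ∣ a_ℓ(V)`** at a good prime `ℓ ≠ p` of a partner pair (`(ℓ/p)` is a unit). [cite: SilvermanAEC2009, X.2 with Exercise 10.16] -/
theorem dvd_frobeniusTrace_partner_iff (hp2 : p ≠ 2) (hVW : C • W.quadraticTwist ((-1) ^ (p / 2) * p) = V)
    (ℓ : ℕ) [hℓ : Fact ℓ.Prime] (hℓp : ℓ ≠ p) (hgoodV : V.HasGoodReductionAtPrime ℓ) (hgoodW : W.HasGoodReductionAtPrime ℓ) :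
    (p : ℤ) ∣ W.frobeniusTrace ℓ ↔ (p : ℤ) ∣ V.frobeniusTrace ℓ := by
  have hpℓ : ¬ p ∣ ℓ := fun h => hℓp ((Nat.prime_dvd_prime_iff_eq hp.out hℓ.out).mp h).symm
  have hℓ0 : ((ℓ : ℤ) : ZMod p) ≠ 0 := by
    rw [Int.cast_natCast, Ne, ZMod.natCast_eq_zero_iff]
    exact hpℓ
  have hW := frobeniusTrace_partner_eq_legendreSym_mul V W C p hp2 hVW ℓ hℓp hgoodV hgoodW
  have hsq : legendreSym p ℓ * legendreSym p ℓ = 1 := by rw [← sq]; exact legendreSym.sq_one p hℓ0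
  have hV : V.frobeniusTrace ℓ = legendreSym p ℓ * W.frobeniusTrace ℓ := by
    rw [hW, ← mul_assoc, hsq, one_mul]
  constructor
  · intro h; rw [hV]; exact h.mul_left _
  · intro h; rw [hW]; exact h.mul_left _

end Partner

/-! ## §2 On a row: the discriminant law and the anomalous primes of the PARTNER -/

section Row

variable (V W : WeierstrassCurve ℚ) [V.IsElliptic] [V.IsGloballyMinimal] [W.IsElliptic] [W.IsGloballyMinimal]
  (C : VariableChange ℚ)

/-- **Discriminant law for the partner.** On a row of crux 19606 (`V/ℚ` globally minimal, `p ≥ 5` good, `a_p = 0`, tower not onto) with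
additive partner `W` (`C • W^{(p*)} = V`), at every prime `ℓ ≠ p` good for both: `p ∣ a_ℓ(W)`, or `a_ℓ(W)² − 4ℓ ≡ 0 (mod p)`, or
`a_ℓ(W)² − 4ℓ` is a non-residue mod `p` (the discriminants of `V` and `W` at `ℓ` coincide). [cite: Serre1972, §2.2]
[cite: SilvermanAEC2009, X.2 with Exercise 10.16] -/
theorem dvd_frobeniusTrace_or_discr_partner_of_row (p : ℕ) [Fact p.Prime] (hp5 : 5 ≤ p)
    (hVW : C • W.quadraticTwist ((-1) ^ (p / 2) * p) = V) (hgood : V.HasGoodReductionAtPrime p) (hap : V.frobeniusTrace p = 0)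
    (hns : ¬ ∀ m : ℕ, V.HasSurjectiveModNGaloisRep (p ^ m : ℕ)) (ℓ : ℕ) [Fact ℓ.Prime] (hℓp : ℓ ≠ p)
    (hgoodV : V.HasGoodReductionAtPrime ℓ) (hgoodW : W.HasGoodReductionAtPrime ℓ) :
    (p : ℤ) ∣ W.frobeniusTrace ℓ ∨ ((W.frobeniusTrace ℓ ^ 2 - 4 * ℓ : ℤ) : ZMod p) = 0 ∨
      ¬ IsSquare ((W.frobeniusTrace ℓ ^ 2 - 4 * ℓ : ℤ) : ZMod p) := by
  have hp2 : p ≠ 2 := by omega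
  rw [dvd_frobeniusTrace_partner_iff V W C p hp2 hVW ℓ hℓp hgoodV hgoodW,
    frobeniusTrace_partner_sq_eq V W C p hp2 hVW ℓ hℓp hgoodV hgoodW]
  exact dvd_frobeniusTrace_or_discr_of_row V p hp5 hgood hap hns ℓ hℓp hgoodV

/-- **The anomalous good primes of the PARTNER are `≡ ±1 (mod p)`.** On a row of crux 19606 with additive partner `W`, a prime
`ℓ ≠ p` good for both with `p ∣ ℓ + 1 − a_ℓ(W)` (`= #W̃(𝔽_ℓ)`) satisfies `ℓ ≡ 1` or `ℓ ≡ −1 (mod p)` — the case `c = (ℓ/p)` of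
`natCast_eq_one_or_eq_neg_one_of_dvd_eulerFactor_of_row`. So the `η`-branch local terms of the `λ`-transfer at good primes (those of
`W`) live only at `ℓ ≡ ±1 (mod p)`. [cite: Serre1972, §2.2] [cite: SilvermanAEC2009, X.2 with Exercise 10.16] -/
theorem natCast_eq_one_or_eq_neg_one_of_anomalous_partner_of_row (p : ℕ) [hp : Fact p.Prime] (hp5 : 5 ≤ p)
    (hVW : C • W.quadraticTwist ((-1) ^ (p / 2) * p) = V) (hgood : V.HasGoodReductionAtPrime p) (hap : V.frobeniusTrace p = 0)
    (hns : ¬ ∀ m : ℕ, V.HasSurjectiveModNGaloisRep (p ^ m : ℕ)) (ℓ : ℕ) [hℓ : Fact ℓ.Prime] (hℓp : ℓ ≠ p)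
    (hgoodV : V.HasGoodReductionAtPrime ℓ) (hgoodW : W.HasGoodReductionAtPrime ℓ)
    (hdvd : (p : ℤ) ∣ (ℓ : ℤ) + 1 - W.frobeniusTrace ℓ) :
    (ℓ : ZMod p) = 1 ∨ (ℓ : ZMod p) = -1 := by
  have hp2 : p ≠ 2 := by omega
  have hpℓ : ¬ p ∣ ℓ := fun h => hℓp ((Nat.prime_dvd_prime_iff_eq hp.out hℓ.out).mp h).symm
  have hℓ0 : ((ℓ : ℤ) : ZMod p) ≠ 0 := by
    rw [Int.cast_natCast, Ne, ZMod.natCast_eq_zero_iff]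
    exact hpℓ
  have hc : legendreSym p ℓ = 1 ∨ legendreSym p ℓ = -1 := legendreSym.eq_one_or_neg_one p hℓ0
  refine natCast_eq_one_or_eq_neg_one_of_dvd_eulerFactor_of_row V p hp5 hgood hap hns ℓ hℓp hgoodV hc ?_
  rw [← frobeniusTrace_partner_eq_legendreSym_mul V W C p hp2 hVW ℓ hℓp hgoodV hgoodW]
  exact hdvd

end Row

end Summit.BirchSwinnertonDyer.BirchSwinnertonDyer.Theorems.EtaCartanField

end
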